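import Summits.QuantumFields.BalabanUV.T4Continuum.Support.NE7AdjointGramCoercivity
import HarnessLib

/-!
# NE7TensionKernelPerturbed — STEP (E3‴) OF THE ENERGY ROAD: the exact-current bound `‖T‖² ≲ ‖S′T‖²∕λ′ + (Λ′²∕λ′+1)θ₀²` when the functional `τ`
# annihilates the kernel of an operator `S` that is only `δ`-CLOSE to the operator `S′` whose Gram form one controls, the closeness
# `|τψ − ⟪ψ,T⟫| ≤ θ₀‖ψ‖` holds only on a subspace `K ∋ T` (the skew directions), and `ker S` splits along `K ⊕ Kᗮ`

Cell `pub-balaban`, rung (B)+1 sub-cell t4, lineage `b2b-balaban-t4-ne7-p1`, generation 63 (CRUX PROVER NE7 #1, ruling e34b3e0c (2)); hunt (h7)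
«ENERGY ROAD», memo v2 §6.  WHY.  Gen 62's exact-current form (`NE7TensionKernelCoercivity.normSq_le_of_exact_annihilator`) asks of ONE operator `S`
three things: `τ = 0` on `ker S` (criticality + gauge invariance give this for the EXACT straight part `S = QbarIter` of the linearised `k`-fold average,
`NE3TangentCovariantTower` + §4 of that file), two-sided Gram bounds, and a small `‖S T̃‖`.  This generation proved the last two for the IDEALISED comb line
sum `S′ = TWg M (combFrame W M)` (`NE7CombLineSumGramBounds` ∕ `…Coercive`: `λ′‖μ‖² ≤ ‖S′†μ‖² ≤ Λ′²‖μ‖²` EXACTLY at any unitary background;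
`NE7CombLineSumDivergence`: `‖S′T̃‖ = O(d·M^d·a)`), and the NE3 swarm's C1 tower (`NE3CovariantLineSums*`) measures `S − S′`.  THIS FILE is the abstract
step that lets the three live on DIFFERENT operators, and repairs the located gap «`|τψ − ⟪ψ,T⟫| ≤ θ₀‖ψ‖` only for SKEW `ψ`» (`NE7ExactCurrent`):
§1 **`normSq_le_of_exact_annihilator_on`** — as gen 62's theorem, but the closeness is assumed only on a submodule `K ∋ T` and `ker S` is assumed to
   split along `K ⊕ Kᗮ` (`S(ψ₁+ψ₂) = 0 ⇒ Sψ₁ = 0` for `ψ₁ ∈ K ⊥ ψ₂`): the `K`-component of the Riesz vector of `τ` does the job;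
§2 the adjoint-perturbation kit: `‖S − S′‖ ≤ δ`, `λ′‖μ‖² ≤ ‖S′†μ‖²` ⇒ `(√λ′ − δ)²‖μ‖² ≤ ‖S†μ‖²` (**`adjoint_lower_of_near`**; the adjoint is an isometry
   of operator spaces) and `‖S v‖ ≤ (Λ′+δ)‖v‖` (**`opNorm_le_of_near`**);
§3 **`normSq_le_of_exact_annihilator_near`**: under `8δ ≤ √λ′`, `‖T‖² ≤ 13·‖S′T‖²∕λ′ + (7(Λ′+δ)²∕λ′ + 4)·θ₀²` — hypotheses: `τ = 0` on `ker S`, the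
   `K`-splitting of `ker S`, `|τψ − ⟪ψ,T⟫| ≤ θ₀‖ψ‖` on `K ∋ T`, the two Gram bounds for `S′†`, `‖S − S′‖ ≤ δ`.  (Finite-dimensional real inner-product
   spaces; gen 62's `NE7AdjointGramCoercivity` BY NAME for `(ker S)ᗮ ≤ range S†`.)
WHAT THIS LEAVES for (H∃)ᵀ (all NAMED now): the packaging of `QbarIter k W` as a CLM `S` on the torus 1-forms with `τ = 0` on `ker S` (tree:
`dirIter_eq_QbarIter_add_gaugeDir`, `dirIter_gaugeDir`, `hasDerivAt_fineAction_vary_multiLevel`, `NE7ExactCurrent`), its `K`-splitting for `K` = skew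
forms, the C1-tower bound `‖M^d•S − S′‖ ≤ √λ′∕8` (NE3 `NE3CovariantLineSumsL2TowerSharp` ∕ `NE3CombVsTowerEnd` in op-norm currency), and (8) interiority.
HONEST FRAMING (page 1): functional analysis only; nothing about Bałaban's minimisers; NE7, NE3 NOT PRINTED in [Balaban1984PropagatorsI]–
[Balaban1989LargeFieldII] and NOT PROVED; FIXED FINITE torus, rung (B)+1; continuum YM on T⁴ ⇐ BetaPertH ∧ nine spine estimates (0/9 proved);
BetaPertH ⇐ (D1) ∧ (D4) ∧ CAP+tail; G-an2-4 gates asym, D1 and NE2/3/4; NOT infinite volume, NOT mass gap, NOT Clay.  0 def, 0 sorry.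
-/

set_option autoImplicit false

open scoped InnerProductSpace

namespace Summit.QuantumFields.BalabanUV.T4Continuum.NE7TensionKernelPerturbed

open NE7AdjointGramCoercivity (coercive_of_adjoint_lower_bound opNorm_le_of_adjoint_upper_bound)

variable {E F : Type*} [NormedAddCommGroup E] [InnerProductSpace ℝ E] [NormedAddCommGroup F] [InnerProductSpace ℝ F]

/-! ## §1 The exact-current bound with closeness on a subspace `K ∋ T` along which `ker S` splits -/

/-- **(E3) WITH AN EXACT CURRENT, CLOSENESS ON A SUBSPACE.**  `S : E →L[ℝ] F`, `τ : E →L[ℝ] ℝ` vanishing on `ker S`, `K` a submodule with `T ∈ K`,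
`|τ ψ − ⟪ψ, T⟫| ≤ θ₀‖ψ‖` for `ψ ∈ K` only, and `ker S` SPLITS along `K ⊕ Kᗮ` (`ψ₁ ∈ K`, `ψ₂ ∈ Kᗮ`, `S(ψ₁+ψ₂) = 0 ⇒ Sψ₁ = 0`).  If
`λ‖v‖² ≤ ‖Sv‖²` on `(ker S)ᗮ` (`λ > 0`) and `‖Sv‖ ≤ Λ‖v‖` (`Λ ≥ 0`), then `‖T‖² ≤ 4‖ST‖²∕λ + (4Λ²∕λ + 2)θ₀²`.  (The `K`-component `T̂₁` of the Riesz
vector of `τ` lies in `(ker S)ᗮ` and within `θ₀` of `T`.) [folklore] -/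
theorem normSq_le_of_exact_annihilator_on [FiniteDimensional ℝ E] (S : E →L[ℝ] F) (τ : E →L[ℝ] ℝ) (K : Submodule ℝ E) {T : E} (hT : T ∈ K) {θ₀ lam Lam : ℝ}
    (hθ₀ : 0 ≤ θ₀) (hlam : 0 < lam) (hLam : 0 ≤ Lam)
    (hτS : ∀ ψ : E, S ψ = 0 → τ ψ = 0) (hSK : ∀ ψ₁ ∈ K, ∀ ψ₂ ∈ Kᗮ, S (ψ₁ + ψ₂) = 0 → S ψ₁ = 0)
    (hτT : ∀ ψ ∈ K, |τ ψ - ⟪ψ, T⟫_ℝ| ≤ θ₀ * ‖ψ‖)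
    (hcoer : ∀ v : E, v ∈ (LinearMap.ker (S : E →ₗ[ℝ] F))ᗮ → lam * ‖v‖ ^ 2 ≤ ‖S v‖ ^ 2) (hS : ∀ v : E, ‖S v‖ ≤ Lam * ‖v‖) :
    ‖T‖ ^ 2 ≤ 4 * ‖S T‖ ^ 2 / lam + (4 * Lam ^ 2 / lam + 2) * θ₀ ^ 2 := by
  haveI : CompleteSpace E := FiniteDimensional.complete ℝ E
  haveI : CompleteSpace K := FiniteDimensional.complete ℝ K
  haveI : K.HasOrthogonalProjection := Submodule.HasOrthogonalProjection.ofCompleteSpace K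
  -- the Riesz vector of `τ` and its `K`-component
  set That : E := (InnerProductSpace.toDual ℝ E).symm τ with hThat
  have hrep : ∀ ψ : E, ⟪That, ψ⟫_ℝ = τ ψ := fun ψ => InnerProductSpace.toDual_symm_apply
  obtain ⟨T₁, hT₁, T₂, hT₂, hdec⟩ := K.exists_add_mem_mem_orthogonal That
  have hpair : ∀ ψ ∈ K, ⟪T₁, ψ⟫_ℝ = τ ψ := by
    intro ψ hψ
    rw [← hrep ψ, hdec, inner_add_left, Submodule.inner_left_of_mem_orthogonal hψ hT₂, add_zero]
  -- `T̂₁ ⊥ ker S`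
  have hmem : T₁ ∈ (LinearMap.ker (S : E →ₗ[ℝ] F))ᗮ := by
    rw [Submodule.mem_orthogonal]
    intro u hu
    obtain ⟨u₁, hu₁, u₂, hu₂, hudec⟩ := K.exists_add_mem_mem_orthogonal u
    have hSu : S (u₁ + u₂) = 0 := by rw [← hudec]; exact hu
    have hSu₁ : S u₁ = 0 := hSK u₁ hu₁ u₂ hu₂ hSu
    rw [hudec, inner_add_left, real_inner_comm T₁ u₁, hpair u₁ hu₁, hτS u₁ hSu₁, zero_add]
    exact Submodule.inner_left_of_mem_orthogonal hT₁ hu₂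
  -- `‖T̂₁ − T‖ ≤ θ₀`
  have hdist : ‖T₁ - T‖ ≤ θ₀ := by
    have hψ : T₁ - T ∈ K := K.sub_mem hT₁ hT
    have h := hτT (T₁ - T) hψ
    have e : τ (T₁ - T) - ⟪T₁ - T, T⟫_ℝ = ‖T₁ - T‖ ^ 2 := by
      rw [← hpair (T₁ - T) hψ, ← real_inner_comm (T₁ - T) T, ← inner_sub_left, real_inner_self_eq_norm_sq]
    rw [e] at h
    have h' : ‖T₁ - T‖ ^ 2 ≤ θ₀ * ‖T₁ - T‖ := (le_abs_self _).trans h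
    nlinarith [norm_nonneg (T₁ - T), sq_nonneg (θ₀ - ‖T₁ - T‖)]
  -- as in the unrestricted case
  have h1 : lam * ‖T₁‖ ^ 2 ≤ ‖S T₁‖ ^ 2 := hcoer T₁ hmem
  have h2 : ‖S T₁‖ ≤ ‖S T‖ + Lam * θ₀ := by
    have e : S T₁ = S T + S (T₁ - T) := by rw [map_sub]; abel
    rw [e]
    refine (norm_add_le _ _).trans ?_
    have h3 : ‖S (T₁ - T)‖ ≤ Lam * θ₀ := (hS _).trans (mul_le_mul_of_nonneg_left hdist hLam)
    linarith
  have h4 : ‖T‖ ≤ ‖T₁‖ + θ₀ := by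
    have e : T = T₁ - (T₁ - T) := by abel
    rw [e]
    exact (norm_sub_le _ _).trans (by linarith)
  have h5 : ‖T‖ ^ 2 ≤ 2 * ‖T₁‖ ^ 2 + 2 * θ₀ ^ 2 := by
    nlinarith [h4, norm_nonneg T, norm_nonneg T₁, sq_nonneg (‖T₁‖ - θ₀)]
  have h6 : ‖S T₁‖ ^ 2 ≤ 2 * ‖S T‖ ^ 2 + 2 * (Lam * θ₀) ^ 2 := by
    nlinarith [h2, norm_nonneg (S T₁), norm_nonneg (S T), mul_nonneg hLam hθ₀, sq_nonneg (‖S T‖ - Lam * θ₀)]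
  have h7 : ‖T₁‖ ^ 2 ≤ (2 * ‖S T‖ ^ 2 + 2 * (Lam * θ₀) ^ 2) / lam := by
    rw [le_div_iff₀ hlam]; linarith
  have e : 4 * ‖S T‖ ^ 2 / lam + (4 * Lam ^ 2 / lam + 2) * θ₀ ^ 2 = 2 * ((2 * ‖S T‖ ^ 2 + 2 * (Lam * θ₀) ^ 2) / lam) + 2 * θ₀ ^ 2 := by
    field_simp
    ring
  rw [e]
  linarith

/-! ## §2 Adjoint perturbation: Gram bounds survive a `δ`-perturbation of the operator -/

/-- **LOWER GRAM BOUND UNDER PERTURBATION**: if `λ′‖μ‖² ≤ ‖S′†μ‖²` for all `μ` and `‖S − S′‖ ≤ δ` with `δ ≤ √λ′`, then `(√λ′ − δ)²‖μ‖² ≤ ‖S†μ‖²`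
(`‖(S − S′)†‖ = ‖S − S′‖`). [folklore] -/
theorem adjoint_lower_of_near [CompleteSpace E] [CompleteSpace F] (S S' : E →L[ℝ] F) {lam' δ : ℝ} (hlam' : 0 ≤ lam') (hδ : δ ≤ Real.sqrt lam')
    (hlow : ∀ μ : F, lam' * ‖μ‖ ^ 2 ≤ ‖ContinuousLinearMap.adjoint S' μ‖ ^ 2) (hSS' : ‖S - S'‖ ≤ δ) :
    ∀ μ : F, (Real.sqrt lam' - δ) ^ 2 * ‖μ‖ ^ 2 ≤ ‖ContinuousLinearMap.adjoint S μ‖ ^ 2 := by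
  intro μ
  have h1 : Real.sqrt lam' * ‖μ‖ ≤ ‖ContinuousLinearMap.adjoint S' μ‖ := by
    have h := hlow μ
    have e : (Real.sqrt lam' * ‖μ‖) ^ 2 = lam' * ‖μ‖ ^ 2 := by rw [mul_pow, Real.sq_sqrt hlam']
    rw [← e] at h
    exact (pow_le_pow_iff_left₀ (by positivity) (norm_nonneg _) two_ne_zero).mp h
  have h2 : ‖ContinuousLinearMap.adjoint S' μ - ContinuousLinearMap.adjoint S μ‖ ≤ δ * ‖μ‖ := by
    rw [show ContinuousLinearMap.adjoint S' μ - ContinuousLinearMap.adjoint S μ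
        = (ContinuousLinearMap.adjoint S' - ContinuousLinearMap.adjoint S) μ from rfl, ← map_sub]
    refine (ContinuousLinearMap.le_opNorm _ _).trans (mul_le_mul_of_nonneg_right ?_ (norm_nonneg _))
    rw [LinearIsometryEquiv.norm_map, norm_sub_rev]
    exact hSS'
  have h3 : Real.sqrt lam' * ‖μ‖ - δ * ‖μ‖ ≤ ‖ContinuousLinearMap.adjoint S μ‖ := by
    have h := norm_sub_norm_le (ContinuousLinearMap.adjoint S' μ) (ContinuousLinearMap.adjoint S μ)
    linarith
  have h0 : 0 ≤ Real.sqrt lam' * ‖μ‖ - δ * ‖μ‖ := by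
    rw [← sub_mul]; exact mul_nonneg (sub_nonneg.mpr hδ) (norm_nonneg _)
  have h4 := mul_self_le_mul_self h0 h3
  nlinarith [h4]

/-- **OPERATOR NORM UNDER PERTURBATION**: `‖S′v‖ ≤ Λ′‖v‖` and `‖S − S′‖ ≤ δ` give `‖Sv‖ ≤ (Λ′+δ)‖v‖`. [folklore] -/
theorem opNorm_le_of_near (S S' : E →L[ℝ] F) {Lam' δ : ℝ} (hS' : ∀ v : E, ‖S' v‖ ≤ Lam' * ‖v‖) (hSS' : ‖S - S'‖ ≤ δ) :
    ∀ v : E, ‖S v‖ ≤ (Lam' + δ) * ‖v‖ := by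
  intro v
  have h1 : ‖S v - S' v‖ ≤ δ * ‖v‖ := by
    rw [show S v - S' v = (S - S') v from rfl]
    exact (ContinuousLinearMap.le_opNorm _ _).trans (mul_le_mul_of_nonneg_right hSS' (norm_nonneg _))
  have e : S v = S' v + (S v - S' v) := by abel
  rw [e, add_mul]
  exact (norm_add_le _ _).trans (add_le_add (hS' v) h1)

/-! ## §3 The exact-current bound with the Gram form controlled on a NEARBY operator -/

/-- **(E3‴) — EXACT CURRENT ON `ker S`, GRAM FORM OF A `δ`-CLOSE `S′`.**  Finite-dimensional real inner-product spaces; `S, S′ : E →L[ℝ] F`,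
`τ : E →L[ℝ] ℝ`, `K` a submodule, `T ∈ K`; `θ₀, Λ′, δ ≥ 0`, `λ′ > 0`, `8δ ≤ √λ′`.  Hypotheses: `τ = 0` on `ker S`; `ker S` splits along `K ⊕ Kᗮ`;
`|τψ − ⟪ψ,T⟫| ≤ θ₀‖ψ‖` on `K`; `λ′‖μ‖² ≤ ‖S′†μ‖² ≤ Λ′²‖μ‖²` for all `μ`; `‖S − S′‖ ≤ δ`.  Then
`‖T‖² ≤ 13·‖S′T‖²∕λ′ + (7·(Λ′+δ)²∕λ′ + 4)·θ₀²`.  For the energy road: `S′` = the comb line sum (`NE7CombLineSumCoercive`: `λ′ = M^{d−1}M(M²+2)∕3`,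
`Λ′² = M^{d−1}M³`; `NE7CombLineSumDivergence`: `‖S′T̃‖`), `S` = `M^d•` the exact straight part of the linearised `k`-fold average, `τ` = the exact first
variation (`NE7ExactCurrent`, `θ₀ = 12·#Plane·a²·√(dP^d card n)` on the skew forms `K`). [folklore] -/
theorem normSq_le_of_exact_annihilator_near [FiniteDimensional ℝ E] [FiniteDimensional ℝ F] (S S' : E →L[ℝ] F) (τ : E →L[ℝ] ℝ) (K : Submodule ℝ E) {T : E} (hT : T ∈ K)
    {θ₀ lam' Lam' δ : ℝ} (hθ₀ : 0 ≤ θ₀) (hlam' : 0 < lam') (hLam' : 0 ≤ Lam') (hδ0 : 0 ≤ δ) (hδ : 8 * δ ≤ Real.sqrt lam')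
    (hτS : ∀ ψ : E, S ψ = 0 → τ ψ = 0) (hSK : ∀ ψ₁ ∈ K, ∀ ψ₂ ∈ Kᗮ, S (ψ₁ + ψ₂) = 0 → S ψ₁ = 0)
    (hτT : ∀ ψ ∈ K, |τ ψ - ⟪ψ, T⟫_ℝ| ≤ θ₀ * ‖ψ‖)
    (hlow : ∀ μ : F, lam' * ‖μ‖ ^ 2 ≤ ‖ContinuousLinearMap.adjoint S' μ‖ ^ 2)
    (hup : ∀ μ : F, ‖ContinuousLinearMap.adjoint S' μ‖ ^ 2 ≤ Lam' ^ 2 * ‖μ‖ ^ 2) (hSS' : ‖S - S'‖ ≤ δ) :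
    ‖T‖ ^ 2 ≤ 13 * ‖S' T‖ ^ 2 / lam' + (7 * (Lam' + δ) ^ 2 / lam' + 4) * θ₀ ^ 2 := by
  haveI : CompleteSpace E := FiniteDimensional.complete ℝ E
  haveI : CompleteSpace F := FiniteDimensional.complete ℝ F
  have hsq : 0 < Real.sqrt lam' := Real.sqrt_pos.mpr hlam'
  have hδle : δ ≤ Real.sqrt lam' := by linarith
  -- the perturbed constants
  set lamS : ℝ := (Real.sqrt lam' - δ) ^ 2 with hlamS
  have hlamS_ge : 49 / 64 * lam' ≤ lamS := by
    have h1 : 7 / 8 * Real.sqrt lam' ≤ Real.sqrt lam' - δ := by linarith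
    have h2 := mul_self_le_mul_self (by positivity) h1
    have e : 7 / 8 * Real.sqrt lam' * (7 / 8 * Real.sqrt lam') = 49 / 64 * lam' := by
      rw [show 7 / 8 * Real.sqrt lam' * (7 / 8 * Real.sqrt lam') = 49 / 64 * (Real.sqrt lam' * Real.sqrt lam') by ring,
        Real.mul_self_sqrt hlam'.le]
    rw [e] at h2
    rw [hlamS, sq]
    exact h2
  have hlamS_le : lamS ≤ lam' := by
    have h1 : Real.sqrt lam' - δ ≤ Real.sqrt lam' := by linarith
    have h2 := mul_self_le_mul_self (by linarith) h1
    rw [Real.mul_self_sqrt hlam'.le] at h2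
    rw [hlamS, sq]
    exact h2
  have hlamS : 0 < lamS := by nlinarith
  have hδsq : 64 * δ ^ 2 ≤ lam' := by
    have h2 := mul_self_le_mul_self (by positivity) hδ
    rw [Real.mul_self_sqrt hlam'.le] at h2
    nlinarith [h2]
  -- coercivity and norm of `S` from those of `S′`
  have hcoer := coercive_of_adjoint_lower_bound S hlamS (adjoint_lower_of_near S S' hlam'.le hδle hlow hSS')
  have hS' : ∀ v : E, ‖S' v‖ ≤ Lam' * ‖v‖ := opNorm_le_of_adjoint_upper_bound S' hLam' hup
  have hS := opNorm_le_of_near S S' hS' hSS'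
  -- the unperturbed bound for `S`
  have R := normSq_le_of_exact_annihilator_on S τ K hT hθ₀ hlamS (by positivity : 0 ≤ Lam' + δ) hτS hSK hτT hcoer hS
  -- `‖S T‖ ≤ ‖S′ T‖ + δ‖T‖`
  have hST : ‖S T‖ ≤ ‖S' T‖ + δ * ‖T‖ := by
    have h1 : ‖S T - S' T‖ ≤ δ * ‖T‖ := by
      rw [show S T - S' T = (S - S') T from rfl]
      exact (ContinuousLinearMap.le_opNorm _ _).trans (mul_le_mul_of_nonneg_right hSS' (norm_nonneg _))
    have e : S T = S' T + (S T - S' T) := by abel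
    rw [e]
    exact (norm_add_le _ _).trans (by linarith)
  have hST2 : ‖S T‖ ^ 2 ≤ 2 * ‖S' T‖ ^ 2 + 2 * δ ^ 2 * ‖T‖ ^ 2 := by
    nlinarith [hST, norm_nonneg (S T), norm_nonneg (S' T), mul_nonneg hδ0 (norm_nonneg T), sq_nonneg (‖S' T‖ - δ * ‖T‖)]
  -- clear denominators: `lamS‖T‖² ≤ 4‖ST‖² + (4(Λ′+δ)² + 2 lamS)θ₀²`
  have R' : lamS * ‖T‖ ^ 2 ≤ 4 * ‖S T‖ ^ 2 + (4 * (Lam' + δ) ^ 2 + 2 * lamS) * θ₀ ^ 2 := by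
    have e : 4 * ‖S T‖ ^ 2 / lamS + (4 * (Lam' + δ) ^ 2 / lamS + 2) * θ₀ ^ 2
        = (4 * ‖S T‖ ^ 2 + (4 * (Lam' + δ) ^ 2 + 2 * lamS) * θ₀ ^ 2) / lamS := by
      field_simp
    rw [e, le_div_iff₀ hlamS] at R
    linarith
  -- absorb `8δ²‖T‖² ≤ lam'‖T‖²∕8`
  have key : 41 / 64 * lam' * ‖T‖ ^ 2 ≤ 8 * ‖S' T‖ ^ 2 + (4 * (Lam' + δ) ^ 2 + 2 * lam') * θ₀ ^ 2 := by
    have hT2 : 0 ≤ ‖T‖ ^ 2 := sq_nonneg _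
    have hθ2 : 0 ≤ θ₀ ^ 2 := sq_nonneg _
    nlinarith [R', hST2, hlamS_ge, hlamS_le, hδsq, mul_le_mul_of_nonneg_right hlamS_ge hT2, mul_le_mul_of_nonneg_right hlamS_le hθ2,
      mul_le_mul_of_nonneg_right hδsq hT2]
  -- divide by `lam'`
  have e2 : 13 * ‖S' T‖ ^ 2 / lam' + (7 * (Lam' + δ) ^ 2 / lam' + 4) * θ₀ ^ 2
      = (13 * ‖S' T‖ ^ 2 + (7 * (Lam' + δ) ^ 2 + 4 * lam') * θ₀ ^ 2) / lam' := by
    field_simp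
  rw [e2, le_div_iff₀ hlam']
  nlinarith [key, sq_nonneg ‖S' T‖, sq_nonneg θ₀, sq_nonneg (Lam' + δ), hlam'.le, sq_nonneg ‖T‖,
    mul_nonneg (mul_nonneg (by norm_num : (0:ℝ) ≤ 7) (sq_nonneg (Lam' + δ))) (sq_nonneg θ₀)]

end Summit.QuantumFields.BalabanUV.T4Continuum.NE7TensionKernelPerturbed
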